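/-
Copyright (c) 2026. All rights reserved.
Released under Apache 2.0 license as described in the file LICENSE.
Authors: abc-iut cell — seat abc-iut-w4-d104 (gen 2): proof-only — [AbsTopIII] Cor 2.7 (e) functoriality
at the germ MODEL of Prop 2.6 along a HOLOMORPHIC LOCAL ISOMORPHISM between Riemann surfaces (the case of a
finite étale morphism), read in the preferred charts: multipliers are preserved.
-/
import Literature.AnabelianGeometry.AbsoluteAnabelian.HolomorphicCoresGermConjugation
import Literature.AnabelianGeometry.AbsoluteAnabelian.AutHolomorphicSpacesHolTypeProofs
import Mathlib.Analysis.Calculus.Deriv.Inverse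
import HarnessLib

/-!
# [AbsTopIII] Cor 2.7 (e): functoriality of `𝒜_p` along holomorphic étale maps, at the germ model

S. Mochizuki, *Topics in absolute anabelian geometry III* (bib key `MochizukiAbsTopIII2015`), Cor 2.7 (e)
(kurims p.60): the groups `𝒜_p` with their "topological field structures on `𝒜_p ∪ {0}`" and "compatible
isomorphisms `𝒜_p ⥲ 𝒜_{p'}`", where (p.60, l.15–16) "the asserted 'functoriality' is with respect to finite
étale morphisms of Aut-holomorphic orbispaces"; Def 4.1 (i) (p.101) identifies all `𝒜_p` to one field
`𝒜_𝕏 ∪ {0}` "together with the functoriality of the algorithms of Corollary 2.7" (GAP-LEDGER G-w5d226-1).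

At the germ MODEL (abc-iut-w4-d104 gen 0, p412533: `𝒜_p = germAut p`, multipliers `germAutIsoUnits`) a
finite étale morphism `f : X → Y` of Riemann surfaces is, near each point, a HOLOMORPHIC LOCAL ISOMORPHISM;
read in the preferred charts at `x` and `f x` it is the complex-differentiable map
`writtenInExtChartAt 𝓘(ℂ, ℂ) 𝓘(ℂ, ℂ) x f` with a complex-differentiable local inverse.  Building on
`hasDerivAt_conj_mulAffine` (`HolomorphicCoresGermConjugation.lean`, p420903) and on
`differentiableAt_writtenInExtChartAt` (abc-iut-L4-t2/t7, `AutHolomorphicSpacesHolTypeProofs.lean`) this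
PROOF-ONLY file proves:

* `writtenInExtChartAt_localInverse_eventually` — the chart expressions of `f` and of a local inverse `g`
  are inverse to each other near the image point;
* `deriv_writtenInExtChartAt_mul_localInverse_eq_one` — their derivatives at the base points are mutually
  inverse (so non-zero);
* `hasDerivAt_writtenInExtChartAt_conj_mulAffine` — **functoriality of `𝒜` along `f` is "same
  multiplier"**: conjugating the affine representative `z ↦ p + c (z − p)` of an `𝒜_x`-germ (in the chart at
  `x`, `p` = image of `x`) by the chart expression of `f` gives a map with complex derivative `c` at the
  image of `f x` — so the induced `𝒜_x ⥲ 𝒜_{f x}` is `c ↦ c` on multipliers and the induced isomorphism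
  `𝒜_𝕏 ∪ {0} ⥲ 𝒜_𝕐 ∪ {0}` is the IDENTITY of `ℂ` (the anti-holomorphic case gives conjugation:
  `HolomorphicCoresGermAntiholomorphic.lean`).  The chart-transition case `f = id` is
  `HolomorphicCoresGermChartIndependence.lean`.

Refereed pre-IUT material ([AbsTopIII] §2); nothing here bears on the disputed [IUTchIII] Cor. 3.12;
typed ≠ endorsed.  No definitions.
-/

namespace Literature.AnabelianGeometry.AbsoluteAnabelian

open _root_.Complex _root_.Set _root_.Topology _root_.Filter _root_.Metric
open scoped _root_.Manifold _root_.ContDiff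

noncomputable section

universe u

section Etale

variable {X Y : Type u} [TopologicalSpace X] [ChartedSpace ℂ X] [TopologicalSpace Y] [ChartedSpace ℂ Y]

/-- The chart expression of a local inverse `g` of `f` at `f x`, evaluated at the image of `f x`, is the
image of `x` in the chart at `x`. (Auxiliary.) [cite: MochizukiAbsTopIII2015, Corollary 2.7 (e) p.60] -/
theorem writtenInExtChartAt_localInverse_apply {f : X → Y} {g : Y → X} {x : X} (hgf : g (f x) = x) :
    (extChartAt 𝓘(ℂ, ℂ) x ∘ g ∘ (extChartAt 𝓘(ℂ, ℂ) (f x)).symm) (extChartAt 𝓘(ℂ, ℂ) (f x) (f x)) =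
      extChartAt 𝓘(ℂ, ℂ) x x := by
  simp only [Function.comp_apply, extChartAt_to_inv, hgf]

/-- Near the image of `f x`, the chart expression of `f` after the chart expression of a local inverse `g`
(`f ∘ g = id` near `f x`, `g` continuous at `f x` with `g (f x) = x`) is the identity. (Auxiliary.)
[cite: MochizukiAbsTopIII2015, Corollary 2.7 (e) p.60] -/
theorem writtenInExtChartAt_localInverse_eventually {f : X → Y} {g : Y → X} {x : X}
    (hg : ContinuousAt g (f x)) (hgf : g (f x) = x) (hfg : ∀ᶠ w in 𝓝 (f x), f (g w) = w) :
    ∀ᶠ z in 𝓝 (extChartAt 𝓘(ℂ, ℂ) (f x) (f x)),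
      writtenInExtChartAt 𝓘(ℂ, ℂ) 𝓘(ℂ, ℂ) x f
        ((extChartAt 𝓘(ℂ, ℂ) x ∘ g ∘ (extChartAt 𝓘(ℂ, ℂ) (f x)).symm) z) = z := by
  -- the relevant neighbourhoods of `f x`, pulled back along the inverse chart at `f x`
  have hsrc : g ⁻¹' (extChartAt 𝓘(ℂ, ℂ) x).source ∈ 𝓝 (f x) := by
    apply hg.preimage_mem_nhds
    rw [hgf]
    exact extChartAt_source_mem_nhds (I := 𝓘(ℂ, ℂ)) x
  have hS := extChartAt_preimage_mem_nhds' (I := 𝓘(ℂ, ℂ))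
    (mem_extChartAt_source (I := 𝓘(ℂ, ℂ)) (f x)) (inter_mem hsrc hfg)
  have hT : (extChartAt 𝓘(ℂ, ℂ) (f x)).target ∈ 𝓝 (extChartAt 𝓘(ℂ, ℂ) (f x) (f x)) :=
    extChartAt_target_mem_nhds' (mem_extChartAt_target (I := 𝓘(ℂ, ℂ)) (f x))
  filter_upwards [hS, hT] with z hz hzt
  simp only [mem_preimage, mem_inter_iff, mem_setOf_eq] at hz
  obtain ⟨hz₁, hz₂⟩ := hz
  simp only [writtenInExtChartAt, Function.comp_apply]
  rw [(extChartAt 𝓘(ℂ, ℂ) x).left_inv hz₁, hz₂, (extChartAt 𝓘(ℂ, ℂ) (f x)).right_inv hzt]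

/-- **Mutually inverse derivatives**: for `f` complex-differentiable at `x` with a local inverse `g`
complex-differentiable at `f x`, the chart expressions have derivatives with product `1` at the base points
(hence both non-zero). [cite: MochizukiAbsTopIII2015, Corollary 2.7 (e) p.60] -/
theorem deriv_writtenInExtChartAt_mul_localInverse_eq_one {f : X → Y} {g : Y → X} {x : X}
    (hf : MDifferentiableAt 𝓘(ℂ, ℂ) 𝓘(ℂ, ℂ) f x) (hg : MDifferentiableAt 𝓘(ℂ, ℂ) 𝓘(ℂ, ℂ) g (f x))
    (hgf : g (f x) = x) (hfg : ∀ᶠ w in 𝓝 (f x), f (g w) = w) :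
    deriv (writtenInExtChartAt 𝓘(ℂ, ℂ) 𝓘(ℂ, ℂ) x f) (extChartAt 𝓘(ℂ, ℂ) x x) *
      deriv (extChartAt 𝓘(ℂ, ℂ) x ∘ g ∘ (extChartAt 𝓘(ℂ, ℂ) (f x)).symm)
        (extChartAt 𝓘(ℂ, ℂ) (f x) (f x)) = 1 := by
  have hT : HasDerivAt (writtenInExtChartAt 𝓘(ℂ, ℂ) 𝓘(ℂ, ℂ) x f) _ (extChartAt 𝓘(ℂ, ℂ) x x) :=
    (differentiableAt_writtenInExtChartAt hf).hasDerivAt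
  have hT'₀ := (differentiableAt_writtenInExtChartAt hg).hasDerivAt
  -- the chart expression of `g` at `f x` is `chart_x ∘ g ∘ chart_{f x}⁻¹` since `g (f x) = x`
  have hrw : writtenInExtChartAt 𝓘(ℂ, ℂ) 𝓘(ℂ, ℂ) (f x) g =
      extChartAt 𝓘(ℂ, ℂ) x ∘ g ∘ (extChartAt 𝓘(ℂ, ℂ) (f x)).symm := by
    simp only [writtenInExtChartAt, hgf]
  rw [hrw] at hT'₀
  have hT₁ : HasDerivAt (writtenInExtChartAt 𝓘(ℂ, ℂ) 𝓘(ℂ, ℂ) x f)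
      (deriv (writtenInExtChartAt 𝓘(ℂ, ℂ) 𝓘(ℂ, ℂ) x f) (extChartAt 𝓘(ℂ, ℂ) x x))
      ((extChartAt 𝓘(ℂ, ℂ) x ∘ g ∘ (extChartAt 𝓘(ℂ, ℂ) (f x)).symm)
        (extChartAt 𝓘(ℂ, ℂ) (f x) (f x))) := by
    rw [writtenInExtChartAt_localInverse_apply hgf]; exact hT
  have hcomp := hT₁.comp (extChartAt 𝓘(ℂ, ℂ) (f x) (f x)) hT'₀
  have hid : HasDerivAt (fun z : ℂ => z) _ (extChartAt 𝓘(ℂ, ℂ) (f x) (f x)) :=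
    hcomp.congr_of_eventuallyEq
      ((writtenInExtChartAt_localInverse_eventually hg.continuousAt hgf hfg).mono fun z hz => hz.symm)
  have huniq := hid.unique (hasDerivAt_id (extChartAt 𝓘(ℂ, ℂ) (f x) (f x)))
  exact huniq

/-- **[AbsTopIII] Cor 2.7 (e) — functoriality of `𝒜` along a holomorphic local isomorphism is "same
multiplier" (germ model).**  Let `f : X → Y` be complex-differentiable at `x` with a local inverse `g`
(complex-differentiable at `f x`, `g (f x) = x`, `f ∘ g = id` near `f x`) — e.g. `f` finite étale and
holomorphic.  Conjugating the affine representative `z ↦ p + c (z − p)` (`p` = image of `x` in its chart) of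
the `𝒜_x`-germ of multiplier `c` by the chart expression of `f` (with inverse the chart expression of `g`)
yields a map with complex derivative `c` at the image of `f x`.  Hence the induced `𝒜_x ⥲ 𝒜_{f x}` is the
identity on multipliers, and the induced `𝒜_𝕏 ∪ {0} ⥲ 𝒜_𝕐 ∪ {0}` is `id : ℂ → ℂ`.
[cite: MochizukiAbsTopIII2015, Corollary 2.7 (e) p.60] -/
theorem hasDerivAt_writtenInExtChartAt_conj_mulAffine {f : X → Y} {g : Y → X} {x : X}
    (hf : MDifferentiableAt 𝓘(ℂ, ℂ) 𝓘(ℂ, ℂ) f x) (hg : MDifferentiableAt 𝓘(ℂ, ℂ) 𝓘(ℂ, ℂ) g (f x))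
    (hgf : g (f x) = x) (hfg : ∀ᶠ w in 𝓝 (f x), f (g w) = w) (c : ℂ) :
    HasDerivAt
      (writtenInExtChartAt 𝓘(ℂ, ℂ) 𝓘(ℂ, ℂ) x f ∘
        (fun z => extChartAt 𝓘(ℂ, ℂ) x x + c * (z - extChartAt 𝓘(ℂ, ℂ) x x)) ∘
        (extChartAt 𝓘(ℂ, ℂ) x ∘ g ∘ (extChartAt 𝓘(ℂ, ℂ) (f x)).symm))
      c (extChartAt 𝓘(ℂ, ℂ) (f x) (f x)) := by
  set d := deriv (writtenInExtChartAt 𝓘(ℂ, ℂ) 𝓘(ℂ, ℂ) x f) (extChartAt 𝓘(ℂ, ℂ) x x) with hd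
  set d' := deriv (extChartAt 𝓘(ℂ, ℂ) x ∘ g ∘ (extChartAt 𝓘(ℂ, ℂ) (f x)).symm)
    (extChartAt 𝓘(ℂ, ℂ) (f x) (f x)) with hd'
  have hT : HasDerivAt (writtenInExtChartAt 𝓘(ℂ, ℂ) 𝓘(ℂ, ℂ) x f) d (extChartAt 𝓘(ℂ, ℂ) x x) :=
    (differentiableAt_writtenInExtChartAt hf).hasDerivAt
  have hT'₀ := (differentiableAt_writtenInExtChartAt hg).hasDerivAt
  have hrw : writtenInExtChartAt 𝓘(ℂ, ℂ) 𝓘(ℂ, ℂ) (f x) g =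
      extChartAt 𝓘(ℂ, ℂ) x ∘ g ∘ (extChartAt 𝓘(ℂ, ℂ) (f x)).symm := by
    simp only [writtenInExtChartAt, hgf]
  rw [hrw] at hT'₀
  have hT' : HasDerivAt (extChartAt 𝓘(ℂ, ℂ) x ∘ g ∘ (extChartAt 𝓘(ℂ, ℂ) (f x)).symm) d'
      (extChartAt 𝓘(ℂ, ℂ) (f x) (f x)) := hT'₀
  have hdd : d * d' = 1 := deriv_writtenInExtChartAt_mul_localInverse_eq_one hf hg hgf hfg
  have hdne : d ≠ 0 := by
    intro h; rw [h, zero_mul] at hdd; exact zero_ne_one hdd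
  have hd'eq : d' = d⁻¹ := eq_inv_of_mul_eq_one_right hdd
  rw [hd'eq] at hT'
  exact hasDerivAt_conj_mulAffine c hT hT' (writtenInExtChartAt_localInverse_apply hgf) hdne

end Etale

end

end Literature.AnabelianGeometry.AbsoluteAnabelian
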